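import Literature.AlgebraicGeometry.HodgeTheory.WeilClassesSplitSquare
import Literature.AlgebraicGeometry.HodgeTheory.WeilClassesMoonenZarhinCriterion
import HarnessLib

/-!
# Deligne's `A₀ ⊗ ℚ(ζ₈) = (T × T) × (T × T)`: a non-zero ALGEBRAIC class on every Weil line of the CM field `ℚ(ζ₈)` — for every abelian variety `T`

Family `hodge`, layer `Literature/AlgebraicGeometry/HodgeTheory`. Companion of `WeilClassesSplitSquare`
(Deligne, LNM 900 (1982) §4, Lemma 4.5 / Remark 4.10 for an imaginary QUADRATIC `E = K`), now for the
quartic CM field `E = ℚ(ζ₈)`, `[E : ℚ] = 4 > 2` — the setting of the ladder's rung R3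
(`WeilTypeLadder.WeilClassesCMField`, Weil classes `weilClassesField` for CM fields of degree `> 2`:
"nothing in print for the GENERAL member for any `e > 2`"). NO named fact, NO definition, NO sorry.

Construction. For ANY complex abelian variety `T` (dimension `g ≥ 1`) put `T₂ = T × T` with Deligne's
`Φ₁ = prodLift (snd ≫ (-𝟙)) fst` (`Φ₁² = -1`: `ℚ(i)` through the regular representation) and
`A = T₂ × T₂` with `Ψ = prodLift (snd ≫ Φ₁) fst`, i.e. `Ψ(X, Y) = (Φ₁ Y, X)`; then `Ψ² = Φ₁ × Φ₁`,
`Ψ⁴ = -1`, so `ζ₈ ↦ Ψ` makes `A = T ⊗_ℚ ℚ(ζ₈)` (`ℤ[ζ₈] = ℤ[i] ⊕ ℤ[i]ζ₈`). With the four projections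
`q₁ = fst ≫ fst, q₂ = fst ≫ snd, q₃ = snd ≫ fst, q₄ = snd ≫ snd : A ⟶ T`:
`Ψ ≫ q₁ = -q₄`, `Ψ ≫ q₂ = q₃`, `Ψ ≫ q₃ = q₁`, `Ψ ≫ q₄ = q₂`, hence for every `c` with `c⁴ = -1` and
`v ∈ H¹(T(ℂ); ℂ)` the class `w_c(v) = q₁^*v + c²·q₂^*v + c·q₃^*v + c³·q₄^*v` is a `c`-eigenvector of `Ψ^*`
(`map_sum_smul_mem_eigenspace_zetaEight`).

* `exists_mem_weilLine_zetaEight_algebraic_ne_zero` — for every `c` with `c⁴ = -1` there is a NON-ZERO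
  ALGEBRAIC class in the Weil line `pullbackEigenclasses A Ψ (2g) ((x + yc)^{2g})` of the CM field
  `ℚ(ζ₈)` (the summand `⋀^{2g} V_{ℂ,c}` of `weilClassesField A Ψ (X⁴+1) (2g) = W_{ℚ(ζ₈)} ⊗ ℂ`,
  Moonen–Zarhin 1998 §1): `P_c = ∏ᵢ w_c(eᵢ)` over a basis `e` of `H¹(T)`. PROOF: expanding the `2g`-fold
  product over the choices `J : Fin 2g → Fin 4` of a projection in each slot,
  `P_c = Σ_J c^{s(J)} τ_J` with `s(J) = Σᵢ expo(J i)`, `expo = (0,2,1,3)`, while the ALGEBRAIC class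
  `(q₁+q₂+q₃+q₄)^*[point] = Σ_J τ_J` (additivity of `f ↦ f^*` on `H¹`; the point class `t = ∏ eᵢ` is the
  top class); the endomorphism `u = (q₁, 4q₂, 2q₃, 8q₄)` acts on `τ_J` by `2^{s(J)}`, so the Lagrange
  projectors in `u^*` (which preserve algebraic classes) extract each `σ_s = Σ_{s(J)=s} τ_J`: algebraic;
  hence `P_c = Σ_s c^s σ_s` is algebraic, and `P_c ≠ 0` because `σ₀ = q₁^*t ≠ 0` (`q₁` has a section).
  Deligne's `cl(λ)`, `λ : ℚ(ζ₈) → ℚ`, are the classes `(Σⱼ λⱼ qⱼ)^*[point] = Σ_J λ^J τ_J`.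

What is NOT here (next step, sized in the packet notes of the B2b ladder `hodge-weil`, prover 3 gen 4):
that each such Weil line IS the line `ℂ·P_c` (an adapted eigenbasis of `H¹(A) = ⊕_{c⁴=-1} V_c`,
`dim V_c = 2g`, and the wedge-basis argument of `finrank_pullbackEigenclasses_pow_eq_one` for four
eigenvalues), whence `weilClassesField A Ψ (X⁴+1) (2g) ⊆ Nᵍ` = the body of R3 on the `g(g+1)/2`-dimensional
locus `{T ⊗ ℚ(ζ₈) : T ∈ 𝒜_g}` — Deligne 1982 for `E = ℚ(ζ₈)`, fact-free.

## References

* [Deligne1982HodgeCycles] P. Deligne, LNM 900 (1982), §4 Lemma 4.5 and Remark 4.10 (text read).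
* [MoonenZarhin1998WeilClasses] B. Moonen, Yu. Zarhin, Weil classes on abelian varieties, §1
  (`W_F ⊗ ℂ = ⊕_σ ⋀^r V_{ℂ,σ}`).
* [HatcherAT2002] A. Hatcher, Algebraic Topology (2002), §3.2 Prop. 3.10.
-/

noncomputable section

open CategoryTheory

namespace Literature.AlgebraicGeometry.HodgeTheory

open Literature.AlgebraicTopology.SingularHomology
open Literature.AlgebraicGeometry.Motives

section HodgeTheory

variable {T : Motives.AbelianVariety ℂ} {g : ℕ}

/-! ### The fourfold product `A = (T × T) × (T × T)`, its projections and the endomorphism `Ψ` (`ζ₈`) -/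

/-- **`Ψ ≫ qⱼ`** for `Ψ = prodLift (snd ≫ Φ₁) fst`, `Φ₁ = prodLift (snd ≫ (-𝟙)) fst`:
`Ψ ≫ q₁ = -q₄`, `Ψ ≫ q₂ = q₃`, `Ψ ≫ q₃ = q₁`, `Ψ ≫ q₄ = q₂`. [folklore] -/
theorem zetaEight_comp_proj (T : Motives.AbelianVariety ℂ) :
    let T₂ := T.prod T
    let Φ₁ : T₂ ⟶ T₂ := AbelianVariety.prodLift (AbelianVariety.snd T T ≫ (-(𝟙 T))) (AbelianVariety.fst T T)
    let Ψ : T₂.prod T₂ ⟶ T₂.prod T₂ :=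
      AbelianVariety.prodLift (AbelianVariety.snd T₂ T₂ ≫ Φ₁) (AbelianVariety.fst T₂ T₂)
    (Ψ ≫ (AbelianVariety.fst T₂ T₂ ≫ AbelianVariety.fst T T) =
        -(AbelianVariety.snd T₂ T₂ ≫ AbelianVariety.snd T T)) ∧
      (Ψ ≫ (AbelianVariety.fst T₂ T₂ ≫ AbelianVariety.snd T T) =
        AbelianVariety.snd T₂ T₂ ≫ AbelianVariety.fst T T) ∧
      (Ψ ≫ (AbelianVariety.snd T₂ T₂ ≫ AbelianVariety.fst T T) =
        AbelianVariety.fst T₂ T₂ ≫ AbelianVariety.fst T T) ∧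
      (Ψ ≫ (AbelianVariety.snd T₂ T₂ ≫ AbelianVariety.snd T T) =
        AbelianVariety.fst T₂ T₂ ≫ AbelianVariety.snd T T) := by
  intro T₂ Φ₁ Ψ
  refine ⟨?_, ?_, ?_, ?_⟩
  · rw [← Category.assoc, AbelianVariety.prodLift_fst, Category.assoc, AbelianVariety.prodLift_fst,
      ← Category.assoc, Preadditive.comp_neg, Category.comp_id]
  · rw [← Category.assoc, AbelianVariety.prodLift_fst, Category.assoc, AbelianVariety.prodLift_snd]
  · rw [← Category.assoc, AbelianVariety.prodLift_snd]
  · rw [← Category.assoc, AbelianVariety.prodLift_snd]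


/-- **The `c`-eigenvectors of `Ψ^*` on `H¹` (`c⁴ = -1`)**: `w_c(v) = q₁^*v + c²·q₂^*v + c·q₃^*v + c³·q₄^*v`
satisfies `Ψ^* w_c(v) = c · w_c(v)` (`Ψ^* q₁^* = -q₄^*`, `Ψ^* q₂^* = q₃^*`, `Ψ^* q₃^* = q₁^*`,
`Ψ^* q₄^* = q₂^*` on `H¹`). [cite: Deligne1982HodgeCycles, §4 Lemma 4.5 (proof)] -/
theorem map_sum_smul_mem_eigenspace_zetaEight {c : ℂ} (hc : c ^ 4 = -1) (v : complexBetti T.X 1) :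
    let T₂ := T.prod T
    let Φ₁ : T₂ ⟶ T₂ := AbelianVariety.prodLift (AbelianVariety.snd T T ≫ (-(𝟙 T))) (AbelianVariety.fst T T)
    let Ψ : T₂.prod T₂ ⟶ T₂.prod T₂ :=
      AbelianVariety.prodLift (AbelianVariety.snd T₂ T₂ ≫ Φ₁) (AbelianVariety.fst T₂ T₂)
    complexBetti.map (AbelianVariety.fst T₂ T₂ ≫ AbelianVariety.fst T T).hom.hom.hom 1 v +
        c ^ 2 • complexBetti.map (AbelianVariety.fst T₂ T₂ ≫ AbelianVariety.snd T T).hom.hom.hom 1 v +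
        c • complexBetti.map (AbelianVariety.snd T₂ T₂ ≫ AbelianVariety.fst T T).hom.hom.hom 1 v +
        c ^ 3 • complexBetti.map (AbelianVariety.snd T₂ T₂ ≫ AbelianVariety.snd T T).hom.hom.hom 1 v ∈
      Module.End.eigenspace (complexBetti.map Ψ.hom.hom.hom 1).hom c := by
  intro T₂ Φ₁ Ψ
  obtain ⟨h1, h2, h3, h4⟩ := zetaEight_comp_proj T
  rw [Module.End.mem_eigenspace_iff]
  change complexBetti.map Ψ.hom.hom.hom 1 _ = _
  have e1 : complexBetti.map Ψ.hom.hom.hom 1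
      (complexBetti.map (AbelianVariety.fst T₂ T₂ ≫ AbelianVariety.fst T T).hom.hom.hom 1 v) =
      -complexBetti.map (AbelianVariety.snd T₂ T₂ ≫ AbelianVariety.snd T T).hom.hom.hom 1 v := by
    rw [complexBetti_map_map_hom, h1, complexBetti_map_neg_deg_one]
  have e2 : complexBetti.map Ψ.hom.hom.hom 1
      (complexBetti.map (AbelianVariety.fst T₂ T₂ ≫ AbelianVariety.snd T T).hom.hom.hom 1 v) =
      complexBetti.map (AbelianVariety.snd T₂ T₂ ≫ AbelianVariety.fst T T).hom.hom.hom 1 v := by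
    rw [complexBetti_map_map_hom, h2]
  have e3 : complexBetti.map Ψ.hom.hom.hom 1
      (complexBetti.map (AbelianVariety.snd T₂ T₂ ≫ AbelianVariety.fst T T).hom.hom.hom 1 v) =
      complexBetti.map (AbelianVariety.fst T₂ T₂ ≫ AbelianVariety.fst T T).hom.hom.hom 1 v := by
    rw [complexBetti_map_map_hom, h3]
  have e4 : complexBetti.map Ψ.hom.hom.hom 1
      (complexBetti.map (AbelianVariety.snd T₂ T₂ ≫ AbelianVariety.snd T T).hom.hom.hom 1 v) =
      complexBetti.map (AbelianVariety.fst T₂ T₂ ≫ AbelianVariety.snd T T).hom.hom.hom 1 v := by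
    rw [complexBetti_map_map_hom, h4]
  have hc3 : c * c ^ 3 = -1 := by rw [← pow_succ', hc]
  rw [map_add, map_add, map_add, map_smul, map_smul, map_smul, e1, e2, e3, e4, smul_add, smul_add,
    smul_add, smul_smul, smul_smul, smul_smul, hc3, ← pow_succ', ← pow_two, neg_one_smul]
  abel

/-! ### The main theorem: a non-zero algebraic class on every `ℚ(ζ₈)`-Weil line -/

/-- **Deligne's `A₀ ⊗ ℚ(ζ₈)`: for every `c` with `c⁴ = -1`, the Weil line `⋀^{2g} V_c` of
`(A, Ψ) = ((T × T) × (T × T), ζ₈)` contains a NON-ZERO ALGEBRAIC class** — for every complex abelian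
variety `T` of dimension `g ≥ 1`: `P_c = ∏ᵢ w_c(eᵢ)` over a basis `e` of `H¹(T)` (module docstring).
[cite: Deligne1982HodgeCycles, §4 Lemma 4.5 and Remark 4.10] [cite: HatcherAT2002, §3.2 Prop. 3.10] -/
theorem exists_mem_weilLine_zetaEight_algebraic_ne_zero (hg : 0 < g) (hT : T.dim = g) {c : ℂ}
    (hc : c ^ 4 = -1) :
    let T₂ := T.prod T
    let Φ₁ : T₂ ⟶ T₂ := AbelianVariety.prodLift (AbelianVariety.snd T T ≫ (-(𝟙 T))) (AbelianVariety.fst T T)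
    let Ψ : T₂.prod T₂ ⟶ T₂.prod T₂ :=
      AbelianVariety.prodLift (AbelianVariety.snd T₂ T₂ ≫ Φ₁) (AbelianVariety.fst T₂ T₂)
    let A := T₂.prod T₂
    ∃ P ∈ pullbackEigenclasses A Ψ (2 * g) (fun x y => ((x : ℂ) + (y : ℂ) * c) ^ (2 * g)),
      P ∈ algebraicClasses A.X g ∧ P ≠ 0 := by
  intro T₂ Φ₁ Ψ A
  classical
  -- the four projections
  let q : Fin 4 → (A ⟶ T) := ![AbelianVariety.fst T₂ T₂ ≫ AbelianVariety.fst T T,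
    AbelianVariety.fst T₂ T₂ ≫ AbelianVariety.snd T T, AbelianVariety.snd T₂ T₂ ≫ AbelianVariety.fst T T,
    AbelianVariety.snd T₂ T₂ ≫ AbelianVariety.snd T T]
  let expo : Fin 4 → ℕ := ![0, 2, 1, 3]
  have hc0 : c ≠ 0 := by rintro rfl; norm_num at hc
  have hX : IsSmoothProjective g T.X := Motives.isSmoothProjective_of_dim_eq' hT
  have hdimA : A.dim = 2 * (2 * g) := by
    change (T₂.prod T₂).dim = _
    rw [AbelianVariety.dim_prod, show T₂.dim = 2 * g from dim_twistedSquare hT]; ring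
  have hXA : IsSmoothProjective (2 * (2 * g)) A.X := Motives.isSmoothProjective_of_dim_eq' hdimA
  -- a basis of `H¹(T)`, the top class `t`
  haveI := finite_complexBetti_abelianVariety T 1
  have hb₁T : Module.finrank ℂ (complexBetti T.X 1) = 2 * g := by
    rw [AbelianVariety.finrank_complexBetti_one, hT]
  let e : Module.Basis (Fin (2 * g)) ℂ (complexBetti T.X 1) := Module.finBasisOfFinrankEq ℂ _ hb₁T
  have hΛT := AbelianVariety.hasExteriorCohomologyH1_complexPoints T
  let BwT : Module.Basis (Set.powersetCard (Fin (2 * g)) (2 * g)) ℂ (complexBetti T.X (2 * g)) :=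
    (e.exteriorPower (2 * g)).map (hΛT.equiv (2 * g))
  have hBwT : ∀ S, BwT S = cupPowOne ℂ (Motives.ComplexPoints T.X) (2 * g)
      (e ∘ (Set.powersetCard.ofFinEmbEquiv.symm S)) := by
    intro S
    change hΛT.equiv (2 * g) ((e.exteriorPower (2 * g)) S) = _
    rw [exteriorPower.basis_apply, HasExteriorCohomologyH1.equiv_apply, exteriorPower.ιMulti_family,
      wedgeToCup_ιMulti]
  set t : complexBetti T.X (2 * g) := cupPowOne ℂ (Motives.ComplexPoints T.X) (2 * g) e with htdef
  have htBw : t = BwT (Set.powersetCard.ofFinEmbEquiv (RelEmbedding.refl _)) := by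
    rw [hBwT, Equiv.symm_apply_apply, htdef]
    rfl
  have ht0 : t ≠ 0 := by rw [htBw]; exact BwT.ne_zero _
  have ht_alg : t ∈ algebraicClasses T.X g := mem_algebraicClasses_of_degree_top hX hg t
  -- the families `f j i = qⱼ^* eᵢ`, the eigenvector family `W` and the class `P`
  let f : Fin 4 → Fin (2 * g) → complexBetti A.X 1 := fun j i => complexBetti.map (q j).hom.hom.hom 1 (e i)
  let W : Fin (2 * g) → complexBetti A.X 1 := fun i => ∑ j : Fin 4, c ^ expo j • f j i
  have hW : ∀ i, W i = f 0 i + c ^ 2 • f 1 i + c • f 2 i + c ^ 3 • f 3 i := by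
    intro i
    change ∑ j : Fin 4, c ^ expo j • f j i = _
    rw [Fin.sum_univ_four]
    have h0 : expo 0 = 0 := rfl
    have h1 : expo 1 = 2 := rfl
    have h2 : expo 2 = 1 := rfl
    have h3 : expo 3 = 3 := rfl
    rw [h0, h1, h2, h3, pow_zero, one_smul, pow_one]
  set P : complexBetti A.X (2 * g) := cupPowOne ℂ (Motives.ComplexPoints A.X) (2 * g) W with hPdef
  have hPeig : P ∈ pullbackEigenclasses A Ψ (2 * g) (fun x y => ((x : ℂ) + (y : ℂ) * c) ^ (2 * g)) := by
    have hWe : ∀ i, W i ∈ Module.End.eigenspace (complexBetti.map Ψ.hom.hom.hom 1).hom c := by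
      intro i
      rw [hW]
      exact map_sum_smul_mem_eigenspace_zetaEight hc (e i)
    have h := cupPowOne_mem_pullbackEigenclasses (lam := fun _ => c) (v := W) hWe
    have eχ : (fun x y : ℕ => ∏ _i : Fin (2 * g), ((x : ℂ) + (y : ℂ) * c)) =
        fun x y : ℕ => ((x : ℂ) + (y : ℂ) * c) ^ (2 * g) := by
      funext x y; rw [Finset.prod_const, Finset.card_univ, Fintype.card_fin]
    rw [← eχ]
    exact h
  -- the terms `τ_J`, `J : Fin 2g → Fin 4`, and the two expansions
  let τ : (Fin (2 * g) → Fin 4) → complexBetti A.X (2 * g) := fun J =>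
    cupPowOne ℂ (Motives.ComplexPoints A.X) (2 * g) (fun i => f (J i) i)
  let sJ : (Fin (2 * g) → Fin 4) → ℕ := fun J => ∑ i, expo (J i)
  have hP_sum : P = ∑ J : Fin (2 * g) → Fin 4, c ^ sJ J • τ J := by
    rw [hPdef]
    change cupPowOne ℂ _ (2 * g) (fun i => ∑ j ∈ (Finset.univ : Finset (Fin 4)), c ^ expo j • f j i) = _
    rw [MultilinearMap.map_sum_finset, Fintype.piFinset_univ]
    refine Finset.sum_congr rfl fun J _ => ?_
    rw [MultilinearMap.map_smul_univ, Finset.prod_pow_eq_pow_sum]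
  set m : A ⟶ T := q 0 + q 1 + q 2 + q 3 with hmdef
  have hmt : complexBetti.map m.hom.hom.hom (2 * g) t = ∑ J : Fin (2 * g) → Fin 4, τ J := by
    rw [htdef, complexBetti_map_cupPowOne]
    have e1 : (fun i => complexBetti.map m.hom.hom.hom 1 (e i)) =
        fun i => ∑ j ∈ (Finset.univ : Finset (Fin 4)), f j i := by
      funext i
      rw [Fin.sum_univ_four, hmdef, complexBetti_map_add_deg_one, complexBetti_map_add_deg_one,
        complexBetti_map_add_deg_one]
    rw [e1, MultilinearMap.map_sum_finset, Fintype.piFinset_univ]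
  have hmt_alg : complexBetti.map m.hom.hom.hom (2 * g) t ∈ algebraicClasses A.X g :=
    map_mem_algebraicClasses_of_abelianVariety hXA T m.hom.hom.hom ht_alg
  -- the separating endomorphism `u = (q₀, 4q₁, 2q₂, 8q₃)`: `u^* τ_J = 2^{s(J)} τ_J`
  let pw : Fin 4 → ℕ := ![1, 4, 2, 8]
  have hpw : ∀ j, pw j = 2 ^ expo j := by
    intro j; fin_cases j <;> rfl
  set u : A ⟶ A := AbelianVariety.prodLift (AbelianVariety.prodLift (q 0) ((pw 1) • q 1))
    (AbelianVariety.prodLift ((pw 2) • q 2) ((pw 3) • q 3)) with hudef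
  have huq : ∀ j, u ≫ q j = (pw j) • q j := by
    intro j
    fin_cases j
    · change u ≫ (AbelianVariety.fst T₂ T₂ ≫ AbelianVariety.fst T T) = (1 : ℕ) • _
      rw [← Category.assoc, hudef, AbelianVariety.prodLift_fst, AbelianVariety.prodLift_fst, one_smul]
      rfl
    · change u ≫ (AbelianVariety.fst T₂ T₂ ≫ AbelianVariety.snd T T) = (pw 1) • _
      rw [← Category.assoc, hudef, AbelianVariety.prodLift_fst, AbelianVariety.prodLift_snd]
      rfl
    · change u ≫ (AbelianVariety.snd T₂ T₂ ≫ AbelianVariety.fst T T) = (pw 2) • _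
      rw [← Category.assoc, hudef, AbelianVariety.prodLift_snd, AbelianVariety.prodLift_fst]
      rfl
    · change u ≫ (AbelianVariety.snd T₂ T₂ ≫ AbelianVariety.snd T T) = (pw 3) • _
      rw [← Category.assoc, hudef, AbelianVariety.prodLift_snd, AbelianVariety.prodLift_snd]
      rfl
  have huf : ∀ j i, complexBetti.map u.hom.hom.hom 1 (f j i) = ((2 : ℂ) ^ expo j) • f j i := by
    intro j i
    change complexBetti.map u.hom.hom.hom 1 (complexBetti.map (q j).hom.hom.hom 1 (e i)) = _
    rw [complexBetti_map_map_hom, huq, complexBetti_map_nsmul_deg_one, ← Nat.cast_smul_eq_nsmul ℂ, hpw,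
      Nat.cast_pow, Nat.cast_ofNat]
  let U : complexBetti A.X (2 * g) →ₗ[ℂ] complexBetti A.X (2 * g) := (complexBetti.map u.hom.hom.hom (2 * g)).hom
  have hUτ : ∀ J, U (τ J) = (2 : ℂ) ^ sJ J • τ J := by
    intro J
    change complexBetti.map u.hom.hom.hom (2 * g) (cupPowOne ℂ _ (2 * g) (fun i => f (J i) i)) = _
    rw [complexBetti_map_cupPowOne]
    have hfun : (fun i => complexBetti.map u.hom.hom.hom 1 (f (J i) i)) =
        fun i => ((2 : ℂ) ^ expo (J i)) • f (J i) i := by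
      funext i; exact huf (J i) i
    rw [hfun, MultilinearMap.map_smul_univ, Finset.prod_pow_eq_pow_sum]
  have hU_alg : ∀ w ∈ algebraicClasses A.X g, U w ∈ algebraicClasses A.X g := fun w hw =>
    map_mem_algebraicClasses_of_abelianVariety hXA A u.hom.hom.hom hw
  -- the projectors `Q_s`, `s ≤ 3·(2g)`
  have hsJ_le : ∀ J, sJ J ≤ 3 * (2 * g) := by
    intro J
    change ∑ i, expo (J i) ≤ _
    calc ∑ i, expo (J i) ≤ ∑ _i : Fin (2 * g), 3 :=
          Finset.sum_le_sum fun i _ => by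
            change (![0, 2, 1, 3] : Fin 4 → ℕ) (J i) ≤ 3
            generalize J i = j
            fin_cases j <;> decide
      _ = 3 * (2 * g) := by rw [Finset.sum_const, Finset.card_univ, Fintype.card_fin, smul_eq_mul, mul_comm]
  let ε : ℕ → ℕ → ℂ := fun k r => if r = k then 0 else (2 : ℂ) ^ r
  let Q : ℕ → (complexBetti A.X (2 * g) →ₗ[ℂ] complexBetti A.X (2 * g)) := fun k =>
    ((List.range (3 * (2 * g) + 1)).map fun r => U - ε k r • (LinearMap.id : _ →ₗ[ℂ] _)).prod
  have hQ_alg : ∀ k, ∀ {w : complexBetti A.X (2 * g)}, w ∈ algebraicClasses A.X g →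
      Q k w ∈ algebraicClasses A.X g :=
    fun k _ hw => listProd_sub_smul_apply_mem (fun _ => U) (ε k) (algebraicClasses A.X g)
      (fun _ w hw => hU_alg w hw) (3 * (2 * g) + 1) hw
  have hQτ : ∀ k J, Q k (τ J) = (∏ r ∈ Finset.range (3 * (2 * g) + 1), ((2 : ℂ) ^ sJ J - ε k r)) • τ J :=
    fun k J => listProd_sub_smul_apply_of_eigen (fun _ => U) (ε k) (fun _ => (2 : ℂ) ^ sJ J) (τ J)
      (fun _ => hUτ J) (3 * (2 * g) + 1)
  have hpow_inj : ∀ a b : ℕ, (2 : ℂ) ^ a = (2 : ℂ) ^ b → a = b := by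
    intro a b h
    exact Nat.pow_right_injective le_rfl (by exact_mod_cast h)
  have hQτ_ne : ∀ k J, sJ J ≠ k → Q k (τ J) = 0 := by
    intro k J hk
    rw [hQτ]
    have hmem : sJ J ∈ Finset.range (3 * (2 * g) + 1) :=
      Finset.mem_range.mpr (Nat.lt_succ_of_le (hsJ_le J))
    rw [Finset.prod_eq_zero hmem (by simp only [ε, if_neg hk, sub_self]), zero_smul]
  have hκ : ∀ k, (∏ r ∈ Finset.range (3 * (2 * g) + 1), ((2 : ℂ) ^ k - ε k r)) ≠ 0 := by
    intro k
    rw [Finset.prod_ne_zero_iff]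
    intro r _
    by_cases hr : r = k
    · simp only [ε, if_pos hr, sub_zero]; exact pow_ne_zero _ two_ne_zero
    · simp only [ε, if_neg hr]
      exact sub_ne_zero.mpr fun h => hr (hpow_inj _ _ h).symm
  -- `σ_k = Σ_{s(J) = k} τ_J` is algebraic
  have hσ_alg : ∀ k, (∑ J ∈ Finset.univ.filter (fun J : Fin (2 * g) → Fin 4 => sJ J = k), τ J) ∈
      algebraicClasses A.X g := by
    intro k
    have hQmt : Q k (complexBetti.map m.hom.hom.hom (2 * g) t) =
        (∏ r ∈ Finset.range (3 * (2 * g) + 1), ((2 : ℂ) ^ k - ε k r)) •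
          ∑ J ∈ Finset.univ.filter (fun J : Fin (2 * g) → Fin 4 => sJ J = k), τ J := by
      rw [hmt, map_sum, Finset.smul_sum, ← Finset.sum_filter_add_sum_filter_not Finset.univ
        (fun J : Fin (2 * g) → Fin 4 => sJ J = k)]
      rw [Finset.sum_eq_zero (s := Finset.univ.filter fun J : Fin (2 * g) → Fin 4 => ¬sJ J = k)
        (fun J hJ => hQτ_ne k J (Finset.mem_filter.mp hJ).2), add_zero]
      refine Finset.sum_congr rfl fun J hJ => ?_
      rw [hQτ, (Finset.mem_filter.mp hJ).2]
    have h := hQ_alg k hmt_alg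
    rw [hQmt] at h
    simpa only [inv_smul_smul₀ (hκ k)] using (algebraicClasses A.X g).smul_mem
      (∏ r ∈ Finset.range (3 * (2 * g) + 1), ((2 : ℂ) ^ k - ε k r))⁻¹ h
  -- hence `P` is algebraic
  have hP_alg : P ∈ algebraicClasses A.X g := by
    rw [hP_sum, ← Finset.sum_fiberwise_of_maps_to (s := Finset.univ) (t := Finset.range (3 * (2 * g) + 1))
      (g := sJ) (fun J _ => Finset.mem_range.mpr (Nat.lt_succ_of_le (hsJ_le J)))]
    refine Submodule.sum_mem _ fun k _ => ?_
    have hk : (∑ J ∈ Finset.univ.filter (fun J : Fin (2 * g) → Fin 4 => sJ J = k), c ^ sJ J • τ J) =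
        c ^ k • ∑ J ∈ Finset.univ.filter (fun J : Fin (2 * g) → Fin 4 => sJ J = k), τ J := by
      rw [Finset.smul_sum]
      refine Finset.sum_congr rfl fun J hJ => ?_
      rw [(Finset.mem_filter.mp hJ).2]
    rw [hk]
    exact (algebraicClasses A.X g).smul_mem _ (hσ_alg k)
  -- and non-zero: the `s = 0` class is `q₀^* t ≠ 0`
  have hs0 : ∀ J : Fin (2 * g) → Fin 4, sJ J = 0 → J = fun _ => 0 := by
    intro J hJ
    funext i
    have hi : expo (J i) = 0 := by
      have := Finset.sum_eq_zero_iff.mp hJ i (Finset.mem_univ i)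
      exact this
    revert hi
    generalize J i = j
    fin_cases j <;> decide
  have hτ0 : τ (fun _ => 0) = complexBetti.map (q 0).hom.hom.hom (2 * g) t := by
    change cupPowOne ℂ _ (2 * g) (fun i => f 0 i) = _
    rw [htdef, complexBetti_map_cupPowOne]
  have hq0t : complexBetti.map (q 0).hom.hom.hom (2 * g) t ≠ 0 := by
    intro h0
    apply ht0
    let s₀ : T ⟶ A := AbelianVariety.prodLift (AbelianVariety.prodLift (𝟙 T) 0) 0
    have hs : s₀ ≫ q 0 = 𝟙 T := by
      change AbelianVariety.prodLift (AbelianVariety.prodLift (𝟙 T) 0) 0 ≫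
        (AbelianVariety.fst T₂ T₂ ≫ AbelianVariety.fst T T) = 𝟙 T
      rw [← Category.assoc, AbelianVariety.prodLift_fst, AbelianVariety.prodLift_fst]
    have : complexBetti.map s₀.hom.hom.hom (2 * g) (complexBetti.map (q 0).hom.hom.hom (2 * g) t) = t := by
      rw [complexBetti_map_map_hom, hs]
      exact abelianVariety_map_id_apply t
    rw [← this, h0, map_zero]
  have hP0 : P ≠ 0 := by
    intro hP
    have h := congrArg (Q 0) hP_sum
    rw [hP, map_zero, map_sum, Finset.sum_eq_single (fun _ : Fin (2 * g) => (0 : Fin 4))] at h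
    · have hs00 : sJ (fun _ => 0) = 0 := by
        change ∑ i : Fin (2 * g), expo 0 = 0
        rw [show expo 0 = 0 from rfl, Finset.sum_const_zero]
      rw [map_smul, hQτ, hs00, pow_zero, one_smul, hτ0] at h
      exact (smul_ne_zero (hκ 0) hq0t) h.symm
    · intro J _ hJ
      rw [map_smul, hQτ_ne 0 J (fun hc' => hJ (hs0 J hc')), smul_zero]
    · intro h'; exact absurd (Finset.mem_univ _) h'
  exact ⟨P, hPeig, hP_alg, hP0⟩

end HodgeTheory

end Literature.AlgebraicGeometry.HodgeTheory

end
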